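import Summits.QuantumFields.YangMills.Theorems.BalabanUVNodesN07Prop8StepTokenOfRecordSym152GClosed
import Summits.QuantumFields.YangMills.Theorems.BalabanUVNodesN07Prop8StepTokenOfRecordSym152GCprimeDprimeB
import HarnessLib

/-!
# N07 [B11] (= [15] = [Balaban1985Variational]) Sect. F — **MODULE 124 = EDITION 119-G: THE GUARDED [15] PROP. 8 STEP TOKEN OF RECORD WITH THE K0 NUMERICS DISCHARGED, GUARD EDITION** — — **PRINT-DATUM EDITION (B): conclusion over `(lamDatum F, dataSmall7LamTopOf F N)`, NO SEAM**
# ✓p750762's `…Prop8StepTokenOfRecordSym152Closed` (119, the landed original this file is a TWIN of — №314 (g-1): token substitution only; statement shape identical; no new displayed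
# hypothesis) VERBATIM except that the ONE conditional premise is the GUARD EDITION (c-ii)‴ `HThm4RecSym152PhiEG F N Mc ρ (F.L * Mh) κ a₀ (ψc·(κ·ε)²)` (MODULE 121; candidate (β′), plan g94
# WORD (B) 2026-08-30) and the composition is MODULE 123 ∘ MODULE 118 (`exists_numerics_budget_symPhiE`, unchanged).  Everything below is 119's header.

PRINT-DATUM TWIN (FLAG №16 ∕ LOCATE-HSEAM 5d3298b8d191f169; S1c of the (E1)∕(iii-b) work plan, director-ym №338∕№339) of the parent named in the imports, which stays landed and true on its
own text (a conditional displaying HSEAM; cf. `not_hseam` ✓p765776): the SAME statement with (i) the conclusion `Prop8RegSepTopStepGB F N suppDom Adm (lamDatum F) (dataSmall7LamTopOf F N) …`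
(F0c ✓p765717 ∕ P0 ✓p766390: print's [II] (2.3) datum «Λ_j = Ω_j^{(j)} ∖ Ω_{j+1}^{(j)} … for the sets of sites and the sets of bonds», p. 224 — ruling (α): the DIFFERENCE of the bond sets,
inward connectors belong to no `Λ_j` — and print's (7) data on `Λ`, [15] p. 278 L20–33), (ii) the HSEAM binder ABSENT — HONESTY GUARD №338 (5): the ONLY displayed premise removed, made
definitionally redundant by the datum change (at `lamDatum` the knit's own fibre rows ARE the (2.3)-cell agreement and print's cell-form criticality; 77c⁵′ᴮ p766698 derives them) — and
(iii) the suppliers replaced by their print-datum twins (122′ `…OfLettersSym152EGB`, 117′ᴮ ✓p766391 `hA1_lam_freeB`, 99″ᴮ `…SymHQnearB`); every numeric letter, guard, constant and the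
conditional premise `hT : HThm4RecSym152PhiEG …` (datum-free) byte-identical; proof = the parent's with three names swapped.  Seat `pub-ymgap-dag-n07-e` g34; `--kind proof --supports
stmt-QuantumFields-20541 --as helper` (K0⁷); count-neutral; def-free.
HONEST SCOPE.  By-name composition; `HThm4RecSym152PhiEG` CONDITIONAL (N05's (B′) road + the cross-term bound); NO stub registered or closed; K0⁷ ∕ K1⁹ NOT closed; N07 NOT discharged; counts
unmoved (typed 28∕28 · discharged 8∕28); one finite 𝕋⁴ programme at fixed ε — the route closes the conditional finite-𝕋⁴ rung `BalabanLadder.UV` ONLY; the YM mass gap (Clay) is NOT proved by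
any of this; nothing continuum ∕ ℝ⁴ ∕ OS.  No `sorry` ∕ `def` ∕ `instance` ∕ `notation`.  PARENT's HEADER FOLLOWS (theorem names carry the suffix `B`∕`_lam` here).

Cell `pub-ymgap`, seat `pub-ymgap-dag-n07-e` g32 (FAN-OUT §N07 row s3; LANE OWNER of the K0 road chart side).  `--kind proof --supports stmt-QuantumFields-20541 --as helper` (K0⁷);
count-neutral; ONE theorem (0 `def`); composition by name.  [15] = [Balaban1985Variational]; [6] = [Balaban1985RegularSpaces]; [3] = [Balaban1985Averaging]; [I] = [Balaban1987RG1].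

WHAT IS PROVED (sorry-free; axioms standard).  ★★★ `prop8RegSepTopStepG_of_hThm4RecSym152PhiEG_closed (F N)` — 119's statement at the G premise.  The consumer (the K0 witness of V22-Z stub 1
`Prop8StepCoPGridGAt`) chooses the integers of the structural rows, takes `κ := b9OfP F Mc ρ B₁` and `a_max := a0OfP …` from N05's (B′) road, the collar `ρ` above MODULE 118 §2's
threshold (`collar_letter_eventually`), receives `a₀ ≤ a_max` and transports the premise down by `hThm4RecSym152PhiEG_mono` (also along `L^{md} ∣ L·Mh`).
WHAT REMAINS DISPLAYED, by name: (1) `HThm4RecSym152PhiEG` ((c-ii)‴ MODULE 121; N05's (B′) road + the φ-junction at the dented datum — CONDITIONAL); (2) HSEAM = (R4) (the (ii)-docket: cell-form criticality on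
`domainsOfSeq s.Ω k` from criticality on the `genSet s.Ω k` fibre — under the tree's inclusive `B15DeterminingSets.bondsOf` reading NOT derivable; the converse is 37a
`N07CritMultiScaleLamBond.isCritOnFibre_genSet_of_critLam`); (3) the collar letter and the structural integers.
HONEST LABEL (binding).  Count-neutral composition; nothing of [15]∕[6]∕[3] ANALYSIS asserted beyond the cited modules; NO stub registered or closed; K0⁷ ∕ K1⁹ NOT closed; N07 NOT
discharged and NOT claimable; counts unmoved (typed 28∕28 · discharged 8∕28); one finite 𝕋⁴ programme at fixed ε — the route closes the conditional finite-𝕋⁴ rung `BalabanLadder.UV`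
ONLY; the YM mass gap (Clay) is NOT proved by any of this; nothing continuum ∕ ℝ⁴ ∕ OS.  No `def`, no `instance`, no `notation`, no `sorry`.

References: [15] Prop. 8 p. 304, (144) p. 300, (147)–(163) pp. 301–304; [6] Thm. 4 p. 88, Prop. 6 (1.130)–(1.138) p. 99; [3] (26) p. 22, (78)–(81) p. 30; [I] (0.4), (0.11) p. 253.
-/

set_option autoImplicit false

noncomputable section

open scoped BigOperators Matrix.Norms.L2Operator

namespace Summit.QuantumFields.YangMills.BalabanUVNodes.N07Prop8StepTokenOfRecordSym152GClosedB

open Literature.MathematicalPhysics.QuantumFieldTheory.Balaban1983to89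
open Literature.MathematicalPhysics.QuantumFieldTheory.Balaban1983to89.Node00
open Literature.MathematicalPhysics.QuantumFieldTheory.Balaban1983to89.B15DeterminingSets
open Literature.MathematicalPhysics.QuantumFieldTheory.Balaban1983to89.B15DeterminingSetsB
open T4Continuum (T4Family)
open GaugeField (gaugeAct)
open Summit.QuantumFields.YangMills.BalabanUVNodes.N07Thm4RecordStructureSym152PhiEG (HThm4RecSym152PhiEG)
open Summit.QuantumFields.YangMills.BalabanUVNodes.N07Prop8StepTokenOfRecordSym152EGCprimeDprimeB (prop8RegSepTopStepGB_of_hThm4RecSym152PhiEG_cprime_dprime_lam)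
open Summit.QuantumFields.YangMills.BalabanUVNodes.N07SymBudgetRowClosure (exists_numerics_budget_symPhiE)

set_option maxHeartbeats 1600000 in
open scoped Classical in
/-- ★★★ **THE [15] PROP. 8 STEP TOKEN OF RECORD WITH THE K0 NUMERICS DISCHARGED — AT PRINT's [II] (2.3) DATUM AND PRINT's (7) DATA, NO SEAM** (print-datum twin of
`prop8RegSepTopStepG_of_hThm4RecSym152PhiEG_closed`, FLAG №16 ∕ LOCATE-HSEAM 5d3298b8d191f169; the (b)-instance stays landed and true on its own text; HSEAM binder absent, conclusion
`Prop8RegSepTopStepGB … (lamDatum F) (dataSmall7LamTopOf F N) …`, supplier 123′) (twin of ✓p750762's `prop8RegSepTopStepG_of_hThm4RecSym152PhiE_closed`: the premise's type is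
(c-ii)‴ at modulus `L·Mh`, the composition calls MODULE 123; every other byte identical): for every admissible collar datum (structural rows as in 100⁵) and every `κ > 0`, `ψc ≥ 0`,
`a_max > 0` with the collar letter `32·sideP·C_H·B_H·e^{−δ_H ρ}·κ·L ≤ 1`, there is `a₀ ∈ (0, a_max]` such that the conditional premise `HThm4RecSym152PhiEG F N Mc ρ (L·Mh) κ a₀ (ψc·(κ·ε)²)`
and HSEAM yield `Prop8RegSepTopStepG F N suppDom Adm B₃ a₀ a₁` for some `B₃ ≥ 2L²`, `a₁ > 0` — 100⁵ ∘ MODULE 118 (`B₃ C θ Q a₀ a₁` chosen by `exists_numerics_budget_symPhiE`).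
[cite: Balaban1985Variational, Prop. 8 p.304, (144) p.300, (147)–(163) pp.301–304; Balaban1985RegularSpaces, Thm. 4 p.88, Prop. 6 (1.130)–(1.138) p.99; Balaban1985Averaging, (26) p.22, (78)–(81) p.30; Balaban1987RG1, (0.4), (0.11) p.253] -/
theorem prop8RegSepTopStepGB_of_hThm4RecSym152PhiEG_closed_lam (F : T4Family) (N : ℕ) [NeZero N] :
    ∃ (Mh₀ R₀ : ℕ) (CH δH BH : ℝ), 0 ≤ CH ∧ 0 < δH ∧ 0 < BH ∧
    ∀ {ρ : ℕ}
      {Mc Mh R a' : ℕ} (_ : 1 ≤ Mc) (_ : Mc ≤ ρ) (_ : Mh = F.L ^ a') (_ : Mh₀ ≤ Mh) (_ : R₀ ≤ R) (_ : F.L * Mh ∣ ρ) (_ : R * (F.L * Mh) ≤ ρ) (hLρ : F.L ≤ ρ)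
      (_ : 2 * F.L ≤ R * (F.L * Mh) + 1)
      {c c₀ : ℕ} (_ : (11 * 4 + 4 * ρ + Mc + 3) * F.L ≤ c) (_ : Mc + 11 * 4 + 6 * ρ + 1 ≤ 2 * F.L ^ c₀) (_ : F.m ≤ c₀) (_ : a' + 3 ≤ c₀)
      (Adm : StepGuard F) (_ : ∀ (ν : Stage7Numerics) (M : ℕ) (g : ℕ → ℝ) (K k : ℕ) (s : SeqOfRecord F ν M g K k), Adm ν M g K k s → c ≤ ν.M₁ ∧ k + c₀ ≤ F.m + K)
      (_ : ∀ (ν : Stage7Numerics) (M : ℕ) (g : ℕ → ℝ) (K k : ℕ) (s : SeqOfRecord F ν M g K k), Adm ν M g K k s → ∀ j : ℕ, 1 ≤ j → j ≤ k →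
        F.L * Mh ∣ M * RkOfRecord (F.P K).L ν.r (g j) ∧ dCubeSide (F.P K).L M (RkOfRecord (F.P K).L ν.r (g j)) j ∣ (F.P K).sitesPerDir 0)
      {κ ψc amax : ℝ} (_ : 0 < κ) (_ : 0 ≤ ψc) (_ : 0 < amax)
      -- ★ THE COLLAR LETTER (⚑ LOCATED-COLLAR-THRESHOLD; MODULE 118 §2 supplies it for every large `ρ`)
      (_ : 32 * ((sideP (F.P 0) Mc ρ : ℕ) : ℝ) * CH * BH * Real.exp (-(δH * (ρ : ℝ))) * (κ * (F.L : ℝ)) ≤ 1),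
      ∃ a₀ : ℝ, 0 < a₀ ∧ a₀ ≤ amax ∧
      -- ★ THE ONE CONDITIONAL PREMISE, GUARD EDITION (c-ii)‴ (candidate (β′)), at the chosen `a₀`, modulus `L·Mh`, defect `Ψ ε j := ψc·(κ·ε_j)²`
      ∀ (_ : HThm4RecSym152PhiEG F N Mc ρ (F.L * Mh) κ a₀ (fun ε j => ψc * (κ * ε j) ^ 2)),
      ∃ B₃ a₁ : ℝ, 2 * (F.L : ℝ) ^ 2 ≤ B₃ ∧ 0 < a₁ ∧
        Prop8RegSepTopStepGB F N (fun ν K Ω => suppDomOfRecord F ν K Ω) Adm (lamDatum F) (dataSmall7LamTopOf F N) B₃ a₀ a₁ := by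
  obtain ⟨Mh₀, R₀, CH, δH, BH, C₁, τ, hCH, hδH, hBH, hC₁, hτ, hmain⟩ := prop8RegSepTopStepGB_of_hThm4RecSym152PhiEG_cprime_dprime_lam F N
  refine ⟨Mh₀, R₀, CH, δH, BH, hCH, hδH, hBH, ?_⟩
  intro ρ Mc Mh R a' hMc hMcρ hMha hMh hR hdvd hRρ hLρ hRM c c₀ hc hc₀ hmc₀ hac₀ Adm hAdm₁ hAdm₂ κ ψc amax hκ hψc hamax hcollar
  obtain ⟨B₃, C, θ, Q, a₀, a₁, hB₃, hC0, hθ0, hQ0, ha₀, haamax, ha₁, hB₃L, hC, hθ, ha, hκa, hκτ, ha₀bud, ha₀gd, ha₀σF, ha₀σS, ha₀σ4, hguard, hguardF, hΨ, hbudget⟩ :=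
    exists_numerics_budget_symPhiE F N Mc ρ hκ hψc hCH hBH hC₁ hτ hamax hcollar
  refine ⟨a₀, ha₀, haamax, fun hT => ⟨B₃, a₁, hB₃L, ha₁, ?_⟩⟩
  exact hmain hMc hMcρ hMha hMh hR hdvd hRρ hLρ hRM hc hc₀ hmc₀ hac₀ Adm hAdm₁ hAdm₂ hB₃ hC0 hθ0 hQ0 hκ hB₃L hC hθ ha hκa hκτ ha₀bud ha₀gd ha₀σF ha₀σS ha₀σ4
    hguard hguardF hΨ hbudget hT

end Summit.QuantumFields.YangMills.BalabanUVNodes.N07Prop8StepTokenOfRecordSym152GClosedB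

end
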